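import Summits.CriticalPhenomena.SAWScalingLimit.Theorems.SAWDefectDecoherenceMassRatioFlatRootDoorShift
import Summits.CriticalPhenomena.SAWScalingLimit.Theorems.SAWDefectDecoherenceMassRatioFlatRootDoorReturn
import Summits.CriticalPhenomena.SAWScalingLimit.Theorems.SAWDefectDecoherenceMassRatioFlatRootRootSwapReduction

/-!
# One-period door comparability on a flat piece of a half-plane sub-domain (crux `MassRatio`, stmt-CriticalPhenomena-8550, line `flat-root-arc-swap`)

Lead-c2 corollary file: the landed door-shift inequality (`DoorShift.doorShift_le`,
`…FlatRootDoorShift.lean`) and the landed arch bound for the adjacent-door return mass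
(`DoorShift.doorReturn_le_of_halfPlane`, `…FlatRootDoorReturn.lean`) combine into a comparability
of critical spin-`0` SAW masses between two ADJACENT door edges `door m p`, `door m p'` (`p' = p ± 2`)
of the bottom row `m` of a domain `Λ ⊆ {row ≥ m}`, with the UNIVERSAL constant
`C₀ = x_c⁻² + 1 + x_c⁻¹/cos(3π/8)` (≈ 9.24):

* `doorShift_le_of_halfPlane` — target form `Z_Λ(e → door p) ≤ C₀ · Z_Λ(e → door p')` (every root `e`
  off the four local edges);
* `doorRootShift_le_of_halfPlane` — root form `Z_Λ(door p → e) ≤ C₀ · Z_Λ(door p' → e)` for mid-edges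
  `e` of the domain (reciprocity `Z(r → z) = Z(z → r)`, `RootSwapArc.Z_symm`);
* `massK_doorShift_le_of_halfPlane` — summed over the `K`-mid-edges: `M_K(door p) ≤ C₀ · M_K(door p')`
  whenever no `K`-mid-edge is one of the four local edges.

This is the `ε = 0`, ADJACENT-PAIR case of the line's tame comparability `FlatArcHarnackAt`
(`…FlatRootRootSwapReduction.lean`) in half-plane sub-domains; iterating it `k` periods costs `C₀^k`,
so it does not give the macroscopic statement. Sources: Duminil-Copin–Smirnov, Ann. of Math. 175
(2012) (arXiv:1007.0575) §3; line card `Cruxes/MassRatio/Lines/flat-root-arc-swap.md`.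
-/

noncomputable section

namespace Summit.CriticalPhenomena.SAWScalingLimit.Theorems.MassRatio.FlatRoot

open Literature.Probability.LatticeModels Literature.Probability.RandomPlanarGeometry
open Literature.Probability.RandomPlanarGeometry.SAW
open Summit.CriticalPhenomena.SAWScalingLimit.Theorems.MassRatio.Negative
open Summit.CriticalPhenomena.SAWScalingLimit.Theorems.MassRatio.Renewal (Z door)

namespace DoorShift

/-- **Half-plane door comparability, target form (registered sub-goal).** For `Λ ⊆ {row ≥ m}`, two
adjacent doors `door m p`, `door m p'` (`p' = p ± 2`, `(p - m)` even) with `bv m p, bv m q, bv m p' ∈ Λ`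
(`q` the position between them) and a root `e` off the four local edges:
`Z_Λ(e → door p) ≤ (x_c⁻² + 1 + x_c⁻¹/cos(3π/8)) · Z_Λ(e → door p')`. -/
theorem doorShift_le_of_halfPlane : ∀ (Λ : Finset HexVertex) (m p p' q : ℤ) (e : Sym2 HexVertex), (∀ v ∈ Λ, m ≤ row v) → (p - m) % 2 = 0 → ((p' = p + 2 ∧ q = p + 1) ∨ (p' = p - 2 ∧ q = p - 1)) → bv m p ∈ Λ → bv m q ∈ Λ → bv m p' ∈ Λ → e ≠ door m p → e ≠ door m p' → e ≠ s(bv m p, bv m q) → e ≠ s(bv m q, bv m p') → Z Λ e (door m p) ≤ (hexCriticalFugacity⁻¹ ^ 2 + 1 + hexCriticalFugacity⁻¹ * (Real.cos (3 * Real.pi / 8))⁻¹) * Z Λ e (door m p') := by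
  intro Λ m p p' q e hΛ hpm hpq hv hu hv' he₁ he₂ he₃ he₄
  have hd : bv (m - 1) p ∉ Λ := fun h => by have := hΛ _ h; rw [row_bv] at this; omega
  have hd' : bv (m - 1) p' ∉ Λ := fun h => by have := hΛ _ h; rw [row_bv] at this; omega
  have hp'm : (p' - m) % 2 = 0 := by rcases hpq with ⟨h, -⟩ | ⟨h, -⟩ <;> omega
  have hne : p ≠ p' := by rcases hpq with ⟨h, -⟩ | ⟨h, -⟩ <;> omega
  have h₁ := doorShift_le Λ m p p' q e hpm hpq hv hu hv' hd hd' he₁ he₂ he₃ he₄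
  have h₂ := doorReturn_le_of_halfPlane Λ m p p' hΛ hpm hp'm hne hv'
  have hx : 0 ≤ hexCriticalFugacity⁻¹ := inv_nonneg.2 hexCriticalFugacity_pos_lt_one.1.le
  have hZ : 0 ≤ Z Λ e (door m p') := norm_nonneg _
  refine h₁.trans (mul_le_mul_of_nonneg_right ?_ hZ)
  have := mul_le_mul_of_nonneg_left h₂ hx
  linarith

/-- **Half-plane door comparability, root form (registered sub-goal).** Same setting, for a
mid-edge `e` of the domain off the four local edges:
`Z_Λ(door p → e) ≤ (x_c⁻² + 1 + x_c⁻¹/cos(3π/8)) · Z_Λ(door p' → e)` (reciprocity). -/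
theorem doorRootShift_le_of_halfPlane : ∀ (Λ : Finset HexVertex) (m p p' q : ℤ) (e : Sym2 HexVertex), (∀ v ∈ Λ, m ≤ row v) → (p - m) % 2 = 0 → ((p' = p + 2 ∧ q = p + 1) ∨ (p' = p - 2 ∧ q = p - 1)) → bv m p ∈ Λ → bv m q ∈ Λ → bv m p' ∈ Λ → e ∈ hexDomainMidEdges Λ → e ≠ door m p → e ≠ door m p' → e ≠ s(bv m p, bv m q) → e ≠ s(bv m q, bv m p') → Z Λ (door m p) e ≤ (hexCriticalFugacity⁻¹ ^ 2 + 1 + hexCriticalFugacity⁻¹ * (Real.cos (3 * Real.pi / 8))⁻¹) * Z Λ (door m p') e := by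
  intro Λ m p p' q e hΛ hpm hpq hv hu hv' he he₁ he₂ he₃ he₄
  have hp'm : (p' - m) % 2 = 0 := by rcases hpq with ⟨h, -⟩ | ⟨h, -⟩ <;> omega
  rw [RootSwapArc.Z_symm (door_mem_midEdges hpm hv) he,
    RootSwapArc.Z_symm (door_mem_midEdges hp'm hv') he]
  exact doorShift_le_of_halfPlane Λ m p p' q e hΛ hpm hpq hv hu hv' he₁ he₂ he₃ he₄

/-- **Half-plane door comparability for the normalised `K`-mass (registered sub-goal).** Same
setting; if no `K`-mid-edge of `Λ` at mesh `δ` is one of the four local edges, then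
`M_K(door p) ≤ (x_c⁻² + 1 + x_c⁻¹/cos(3π/8)) · M_K(door p')`. -/
theorem massK_doorShift_le_of_halfPlane : ∀ (Λ : Finset HexVertex) (m p p' q : ℤ) (δ : ℝ) (K : Set ℂ), (∀ v ∈ Λ, m ≤ row v) → (p - m) % 2 = 0 → ((p' = p + 2 ∧ q = p + 1) ∨ (p' = p - 2 ∧ q = p - 1)) → bv m p ∈ Λ → bv m q ∈ Λ → bv m p' ∈ Λ → (∀ e ∈ {e : Sym2 HexVertex | e ∈ hexDomainMidEdges Λ ∧ (δ : ℂ) * hexMidpoint e ∈ K}, e ≠ door m p ∧ e ≠ door m p' ∧ e ≠ s(bv m p, bv m q) ∧ e ≠ s(bv m q, bv m p')) → massK Λ (door m p) δ K ≤ (hexCriticalFugacity⁻¹ ^ 2 + 1 + hexCriticalFugacity⁻¹ * (Real.cos (3 * Real.pi / 8))⁻¹) * massK Λ (door m p') δ K := by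
  intro Λ m p p' q δ K hΛ hpm hpq hv hu hv' hK
  unfold massK
  rw [mul_left_comm]
  refine mul_le_mul_of_nonneg_left ?_ (sq_nonneg δ)
  have hfin := midEdgesIn_finite Λ δ K
  rw [finsum_mem_eq_finite_toFinset_sum _ hfin, finsum_mem_eq_finite_toFinset_sum _ hfin,
    Finset.mul_sum]
  refine Finset.sum_le_sum fun e he => ?_
  have heS := hfin.mem_toFinset.1 he
  obtain ⟨h₁, h₂, h₃, h₄⟩ := hK e heS
  exact doorRootShift_le_of_halfPlane Λ m p p' q e hΛ hpm hpq hv hu hv' heS.1 h₁ h₂ h₃ h₄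

end DoorShift

end Summit.CriticalPhenomena.SAWScalingLimit.Theorems.MassRatio.FlatRoot
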